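import Mathlib
import Summits.Ventures.PercRepro2.Defs
import Summits.Ventures.PercRepro2.Graph
import Summits.Ventures.PercRepro2.HullDefs
import Summits.Ventures.PercRepro2.LocRows
import Summits.Ventures.PercRepro2.SwRow
import Summits.Ventures.PercRepro2.SwGlue2
import Summits.Ventures.PercRepro2.SwPath
import Summits.Ventures.PercRepro2.SwAllRow
import Summits.Ventures.PercRepro2.SwAllGlue

/-!
# Row 2′SW-ALL on paths and cycles (blind cell PercRepro2, night-4 g5, 2026-08-24;
proofs/NIGHT4-BRIDGE.md §2–§3)

The path permutation `Path2.swapTail` flips every red edge of the red suffix from `h = p k` (those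
edges lie at or after `o = p j`, and the suffix is empty in the all-blue case), so it is a rigid
permutation: row 2′SW-ALL holds on every path with `l`, `h` its ends and `o` interior
(`swAll_path`), hence — by the rigid bridge lemma `Glue2.swAll_glue2` — on every gluing of such a
path with an arbitrary second side at `{l, h}`, the cycles in particular (`swAll_path_glue2`).
-/

namespace Summit.Ventures.PercRepro2

namespace Path2

open Hull LocRows

open scoped Classical

variable {V : Type*} {k : ℕ} {p : Fin (k + 1) → V}

/-- The left end of an edge inside a set of path vertices lies in the set. -/
lemma castSucc_mem_of_mem_within {S : Set V} {i : Fin k}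
    (hi : i ∈ within (pathEnds p) S) : p i.castSucc ∈ S := by
  obtain ⟨x, hx, y, hy, hends⟩ := hi
  simp only [pathEnds] at hends
  rcases Sym2.eq_iff.1 hends with ⟨h₁, _⟩ | ⟨h₁, _⟩
  · rw [h₁]; exact hx
  · rw [h₁]; exact hy

/-- The red suffix from `h` is flipped by `swapTail`. -/
lemma swapTail_flips_red (hp : Function.Injective p) {j : Fin (k + 1)} (hj : 0 < (j : ℕ))
    {ζ : Config (Fin k)}
    (hζ : ζ ∈ tgtU (pathEnds p) (p 0) (p (Fin.last k)) {S : Set V | p j ∈ S}) {i : Fin k}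
    (hi : i ∈ within (pathEnds p) (cluster (pathEnds p) ζ (p (Fin.last k)))) (hred : ζ i = true) :
    swapTail j ζ i = false := by
  rw [mem_tgtU_path_iff hp hj] at hζ
  have hsuf : ∀ i' : Fin k, (i : ℕ) ≤ i' → ζ i' = true := fun i' hi' =>
    (p_mem_cluster_last_iff hp ζ i.castSucc).1 (castSucc_mem_of_mem_within hi) i'
      (by rw [Fin.val_castSucc]; exact hi')
  -- the edge lies at or after `j`
  have hji : (j : ℕ) ≤ i := by
    by_contra hlt; push Not at hlt
    obtain ⟨i', hi'⟩ := hζ.2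
    by_cases hi'j : (i' : ℕ) < j
    · have := hζ.1 i' hi'j; rw [hi'] at this; exact Bool.false_ne_true this
    · push Not at hi'j
      have := hsuf i' (by omega); rw [hi'] at this; exact Bool.false_ne_true this
  have hmix : ¬ ∀ i' : Fin k, (j : ℕ) ≤ i' → ζ i' = false := by
    intro hall
    have := hall i hji; rw [hred] at this; exact Bool.true_eq_false ▸ this
  rw [swapTail_of_le j ζ hmix hji, hred]; rfl

variable (p) in
/-- **Row 2′SW-ALL on a path** with `l = p 0`, `h = p k` and `o = p j` interior. -/
theorem swAll_path (hp : Function.Injective p) {j : Fin (k + 1)} (hj : 0 < (j : ℕ)) :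
    SwAll (pathEnds p) (p 0) (p (Fin.last k)) (p j) := by
  refine ⟨fun x => swapTail j x.1, ?_,
    fun x => ⟨swapTail_mem hp hj x.2, fun i hi hred => swapTail_flips_red hp hj x.2 hi hred⟩⟩
  intro x y hxy
  exact Subtype.ext (swapTail_injOn hp hj x.2 y.2 hxy)

/-- **Row 2′SW-ALL on every gluing of a path with an arbitrary second side at its two ends** — in
particular on every cycle. -/
theorem swAll_path_glue2 {E₂ : Type*} [Fintype E₂] [DecidableEq E₂] {ends₂ : E₂ → Sym2 V}
    {V₁ V₂ : Set V} (hp : Function.Injective p) {j : Fin (k + 1)} (hj : 0 < (j : ℕ))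
    (hjk : (j : ℕ) < k) (hg : Glue2.IsGluing2 (pathEnds p) ends₂ (p 0) (p (Fin.last k)) V₁ V₂)
    (hV₁ : ∀ v, p v ∈ V₁) :
    SwAll (Glue2.glue2 (pathEnds p) ends₂) (p 0) (p (Fin.last k)) (p j) := by
  refine Glue2.swAll_glue2 hg (hV₁ j) ?_ ?_ (swAll_path p hp hj)
  · intro h; have := congrArg Fin.val (hp h); simp only [Fin.val_zero] at this; omega
  · intro h; have := congrArg Fin.val (hp h); simp only [Fin.val_last] at this; omega

end Path2

end Summit.Ventures.PercRepro2
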